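import Mathlib
import Literature.Analysis.FluidPDE.TimePeriodicNSLatticeRealize
import Literature.Analysis.FluidPDE.NSHopfGalerkin
import HarnessLib

/-!
# Crux `WazewskiBlock.UniformWorkFloorTrap` (stmt-AnomalousDissipation-10353), line `work-lipschitz-cycles`:
# stub `stub_synthSlices` — the slices of the real synthesis of a truncated lattice family are Galerkin modes

For a lattice family `c : ℤ × ℤ³ → EuclideanSpace ℂ (Fin 3)` (time frequency `n`, space frequency `k`) that is transversal
(`k · c(n,k) = 0`), conjugate symmetric (`c(-m) = conj c(m)`), band-limited (`c(n,k) = 0` off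
`|k|² ≤ N²`) and whose extension `𝐄c (K) = c (K 0, tail K)` to `ℤ⁴` is rapidly decaying, the real field
`u'(t, x) = Re F_{𝐄c}(ωt, x)` synthesised on `ℝ × T³` from the space–time Fourier synthesis `F_{𝐄c}` on
`T⁴ = UnitAddTorus (Fin 4)` (time coordinate `0`) satisfies:

1. every slice `u' t` is a Galerkin mode of order `N` (`Literature.Analysis.FluidPDE.IsGalerkinMode`:
   smooth, classically divergence free, no Fourier modes off the ball `|k|² ≤ N²`);
2. the spatial Fourier coefficients of the slice at time `t` are the time sums
   `𝓕(complexify ∘ u' t)(k) = ∑ₙ eₙ(ωt) c(n,k)`.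

This is the dictionary between the space–time Fourier lattice and the Galerkin ODE used by the glue
`stub_galerkinCyclePersistence` of the line. Everything is bookkeeping over the tree facts
`TimePeriodicLattice.realSynth_spec'` (the real synthesis is smooth with coefficients `𝐄c`),
`TimePeriodicLattice.mFourierCoeff_timeSlice_fourierSynth` (slice coefficients are time sums),
`TimePeriodicLattice.div_realSynth_eq_zero` (transversal families synthesise divergence-free fields)
and `Torus.divergence_timeSlice`, `Torus.IsSmooth.timeSlice` (slices of smooth fields on `T⁴`).
[folklore; Iooss 1972 §2, Henry 1981 Ch. 8 for the space–time Fourier treatment]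

* `stub_synthSlices` — the registered stub, proved (no hypotheses beyond the registered signature).
-/

noncomputable section

-- `Summit.<Summit>.<Problem>`: single-conjunct summit, the duplicate namespace is mandated (CONVENTIONS §2).
set_option linter.dupNamespace false

namespace Summit.AnomalousDissipation.AnomalousDissipation.Theorems.UniformWorkFloorTrap.WorkLipschitzCycles

open MeasureTheory Filter Set Function UnitAddTorus
open scoped Topology ENNReal ComplexConjugate
open Literature.Analysis.FunctionSpaces Literature.Analysis.FunctionSpaces.Torus
open Literature.Analysis.FunctionSpaces.EuclideanSpace
open Literature.Analysis.FluidPDE Literature.Analysis.FluidPDE.TimePeriodicLattice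

-- NOTATION START (verbatim from the line's skeleton; the registered stub signature is stated with them)
/-- The flat three-torus. -/
local notation "𝕋³" => UnitAddTorus (Fin 3)
/-- Complexified velocity values. -/
local notation "ℂ³" => EuclideanSpace ℂ (Fin 3)
-- NOTATION END

/-- **Slice coefficients of the real synthesis.** For a conjugate-symmetric lattice family `c` with rapidly
decaying extension `𝐄c`, the `k`-th spatial Fourier coefficient of the (complexified) slice at circle time
`s` of the real field `Re F_{𝐄c}` is the time sum `∑ₙ eₙ(s) • c(n,k)`: the real synthesis complexifies back
to `F_{𝐄c}` (`realSynth_spec'`) and the slice coefficients of a synthesis on `T⁴` are the time sums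
(`mFourierCoeff_timeSlice_fourierSynth`). [folklore] -/
theorem mFourierCoeff_complexify_timeSlice_realSynth {c : ℤ × (Fin 3 → ℤ) → EuclideanSpace ℂ (Fin 3)}
    (hcs : ∀ m, c (-m) = conjVec (c m))
    (hcr : RapidDecay (fun K : Fin 4 → ℤ => c (K 0, Fin.tail K))) (s : UnitAddCircle) (k : Fin 3 → ℤ) :
    mFourierCoeff (EuclideanSpace.complexify ∘ timeSlice (fun y : UnitAddTorus (Fin 4) =>
        EuclideanSpace.realPart (fourierSynth (fun K : Fin 4 → ℤ => c (K 0, Fin.tail K)) y)) s) k =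
      ∑' n : ℤ, (fourier n s : ℂ) • c (n, k) := by
  obtain ⟨_, hVreal, _⟩ := realSynth_spec' hcr (ext_neg_eq_conjVec hcs)
  have hfun : (EuclideanSpace.complexify ∘ timeSlice (fun y : UnitAddTorus (Fin 4) =>
        EuclideanSpace.realPart (fourierSynth (fun K : Fin 4 → ℤ => c (K 0, Fin.tail K)) y)) s) =
      timeSlice (fourierSynth (fun K : Fin 4 → ℤ => c (K 0, Fin.tail K))) s := by
    funext x
    have h := congrFun hVreal (Fin.cons s x)
    simp only [Function.comp_apply] at h
    simp only [Function.comp_apply, timeSlice_apply]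
    exact h
  rw [hfun, mFourierCoeff_timeSlice_fourierSynth hcr s k]
  simp only [Fin.cons_zero, Fin.tail_cons]

/-- **Slices of the real synthesis of a truncated lattice family are Galerkin modes.** For a transversal,
conjugate-symmetric lattice family `c` vanishing off `|k|² ≤ N²` with rapidly decaying extension, every
slice of `Re F_{𝐄c}` is smooth (`Torus.IsSmooth.timeSlice`), divergence free (`div_realSynth_eq_zero` read
through `Torus.divergence_timeSlice`) and band-limited to the ball (slice coefficients are time sums of
`c(n,k) = 0`). [folklore] -/
theorem isGalerkinMode_timeSlice_realSynth {c : ℤ × (Fin 3 → ℤ) → EuclideanSpace ℂ (Fin 3)} {N : ℕ}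
    (hct : ∀ m : ℤ × (Fin 3 → ℤ), (∑ jj : Fin 3, ((m.2 jj : ℤ) : ℂ) * (c m) jj) = 0)
    (hcs : ∀ m, c (-m) = conjVec (c m))
    (hcN : ∀ m : ℤ × (Fin 3 → ℤ), (N : ℝ) ^ 2 < freqNormSq m.2 → c m = 0)
    (hcr : RapidDecay (fun K : Fin 4 → ℤ => c (K 0, Fin.tail K))) (s : UnitAddCircle) :
    IsGalerkinMode N (timeSlice (fun y : UnitAddTorus (Fin 4) =>
        EuclideanSpace.realPart (fourierSynth (fun K : Fin 4 → ℤ => c (K 0, Fin.tail K)) y)) s) := by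
  obtain ⟨hV's, _, _⟩ := realSynth_spec' hcr (ext_neg_eq_conjVec hcs)
  refine ⟨hV's.timeSlice s, fun x => ?_, fun k hk => ?_⟩
  · -- divergence of the slice, read on `T⁴`
    rw [divergence_timeSlice]
    have h := div_realSynth_eq_zero (m₀ := 0) hct hcs hcr (Fin.cons s x)
    simpa only [zero_add] using h
  · -- band limitation: the slice coefficient is the time sum of `c(n,k) = 0`
    rw [mFourierCoeff_complexify_timeSlice_realSynth hcs hcr s k]
    have h0 : ∀ n : ℤ, (fourier n s : ℂ) • c (n, k) = 0 := fun n => by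
      rw [hcN (n, k) hk, smul_zero]
    rw [tsum_congr h0, tsum_zero]

/-- **S5 · Slices of the real synthesis** (registered stub of the line `work-lipschitz-cycles`). For a
transversal conjugate-symmetric lattice family `c` on `ℤ × ℤ³` vanishing on the zero spatial modes and off
`|k|² ≤ N²`, with rapidly decaying extension to `ℤ⁴`, the real field
`u'(t,x) = Re F_{𝐄c}(ωt, x)` has Galerkin-mode slices of order `N` at every time, and the spatial Fourier
coefficients of the slice at time `t` are the time sums `∑ₙ eₙ(ωt) c(n,k)`. [folklore] -/
theorem stub_synthSlices (c : ℤ × (Fin 3 → ℤ) → ℂ³) (N : ℕ) (ω : ℝ)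
    (_hc0 : ∀ n : ℤ, c (n, 0) = 0)
    (hct : ∀ m : ℤ × (Fin 3 → ℤ), (∑ jj : Fin 3, ((m.2 jj : ℤ) : ℂ) * (c m) jj) = 0)
    (hcs : ∀ m, c (-m) = conjVec (c m))
    (hcN : ∀ m : ℤ × (Fin 3 → ℤ), (N : ℝ) ^ 2 < freqNormSq m.2 → c m = 0)
    (hcr : RapidDecay (fun K : Fin 4 → ℤ => c (K 0, Fin.tail K))) :
    (∀ t : ℝ, IsGalerkinMode N (fun x : 𝕋³ => EuclideanSpace.realPart
        (fourierSynth (fun K : Fin 4 → ℤ => c (K 0, Fin.tail K)) (Fin.cons (((ω * t : ℝ)) : UnitAddCircle) x)))) ∧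
    (∀ (t : ℝ) (k : Fin 3 → ℤ), mFourierCoeff (EuclideanSpace.complexify ∘ fun x : 𝕋³ => EuclideanSpace.realPart
        (fourierSynth (fun K : Fin 4 → ℤ => c (K 0, Fin.tail K)) (Fin.cons (((ω * t : ℝ)) : UnitAddCircle) x))) k =
        ∑' n : ℤ, (fourier n (((ω * t : ℝ)) : UnitAddCircle) : ℂ) • c (n, k)) :=
  ⟨fun t => isGalerkinMode_timeSlice_realSynth hct hcs hcN hcr (((ω * t : ℝ)) : UnitAddCircle),
    fun t k => mFourierCoeff_complexify_timeSlice_realSynth hcs hcr (((ω * t : ℝ)) : UnitAddCircle) k⟩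

end Summit.AnomalousDissipation.AnomalousDissipation.Theorems.UniformWorkFloorTrap.WorkLipschitzCycles

end
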